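import Summits.QuantumFields.YangMills.Theorems.BalabanUVNodesPortS1G3CRemainder
import Summits.QuantumFields.YangMills.Theorems.BalabanUVNodesPortS1G3CBlockDist

/-!
# NODE O port PT-A — `stub_G3C` (repaired edition `G3CAtRecordL`), layer (D3b): THE NEAR-STEP BOUND — for a piece `Y` AVOIDING the `3^d` block of `□` (every cube of `Y` off `tblock □`;
# by ✓`one_le_torusTreeLen_or_avoids_tblock` this is the case `d_j(Y) < 1` of a piece sticking out of `□̃`), the step `S_{□,Y} = T_Y·P_□̃·G_□·𝟙_□` only reads entries `G_□(l, m)` with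
# `tdist(l, m) ≥ L·Mc` (✓`mul_le_tdist_of_cube_not_mem_tblock`), so by the lattice Combes–Thomas decay (✓`norm_g3cLocInv_apply_le_exp`)
# `‖S_{□,Y}(x, φ)‖ ≤ c₀e^{−δ₀d_j(Y)} · 3^8·(12·(L·Mc)^4) · e^{−κ·L·Mc}/(γ₀/2)` — the factor that `Mc ≥ Mth'(κt)` makes small (memo §5b (ii))

Cell `ym-nodeO-ideate`, porter hand `hand-27930-G3C` (g0); proof kind, `--supports stmt-QuantumFields-27930 --as helper`; count-neutral.  [B9] = [Balaban1985BackgroundPropagators], [16] = [Balaban1985UV3].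

WHAT THIS FILE PROVES (sorry-free): `card_filter_cube_mem_le` (indices with cube in `S`: `≤ |S|·3d(L·Mc)^d`), `card_filter_inDom_blk_le` (indices of `□̃`: `≤ 3^{2d}·3d(L·Mc)^d`),
`nonB0Block_mul_cubeProj` (column support of `T_Y` in cube form), `W_apply`, `norm_W_apply_le`, `W_apply_eq_zero_of_cube_ne`, `W_apply_eq_zero_of_not_inDom` (entries of
`W := D_Y·P_□̃·G_□·𝟙_□`), ★ `l2_opNorm_W_le`, ★★ `l2_opNorm_g3cStep_le_near`.

HONEST FRAMING.  Elementary bounds under the HYPOTHESES `P0CarrierClauses …` ∧ `P0CarrierLatticeDecay …` (inhabited nowhere); nothing of Bałaban's estimates asserted, ported or discharged;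
`stub_G3C` NOT closed; 27930 OPEN; NODE O 0∕1; COUNT 8∕28 · K 1∕4 UNMOVED; finite `𝕋⁴_{L^K}` at fixed ε — NOT continuum ∕ OS ∕ Clay; **the Yang–Mills mass gap is NOT proved by any of this.**
No `sorry`, no `instance`, no `notation`, no `def`; standard axioms.
-/

noncomputable section

open scoped BigOperators Matrix.Norms.L2Operator Topology Matrix Classical
open Filter Finset

namespace Summit.QuantumFields.YangMills.Theorems.BalabanUVNodesPortS1

open Summit.QuantumFields.YangMills.Theorems.K0RecordFormatNames
open Literature.MathematicalPhysics.QuantumFieldTheory.Balaban1983to89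
open Literature.MathematicalPhysics.QuantumFieldTheory.Balaban1983to89.Node00
open Literature.MathematicalPhysics.QuantumFieldTheory.Balaban1983to89.T4Continuum (T4Family)
open Literature.MathematicalPhysics.QuantumFieldTheory.Balaban1983to89.TreeLengthTorus (TPt)
open Literature.MathematicalPhysics.QuantumFieldTheory.Balaban1983to89.TreeLengthTorusTransfer (tblock tcollar card_tblock_le card_tcollar_le)
open Literature.MathematicalPhysics.QuantumFieldTheory.Balaban1983to89.B12TreeDecay (K₀ kappa₀)

section Near

variable {F : T4Family}
variable {a₀ δ₀ c₀ γ₀ γ₁ δ₁ : ℝ} {Mc : ℕ} {α₀ α₁ ε₂₉ : ℝ} {k : ℕ}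
variable {TC : (n : ℕ) → Sect2.CPair (F.P (recordK₀ F Mc k + n)) (MatA 2) → FluctIdx F k (recordK₀ F Mc k + n) → FluctIdx F k (recordK₀ F Mc k + n) → ℂ}
variable {TY : (n : ℕ) → (recordDomSys F Mc k (recordK₀ F Mc k + n)).Dom → Sect2.CPair (F.P (recordK₀ F Mc k + n)) (MatA 2) →
  FluctIdx F k (recordK₀ F Mc k + n) → FluctIdx F k (recordK₀ F Mc k + n) → ℂ}
variable {TZY : Finset (Fin 4 → ℤ) → IntBondCfg → ((Fin 4 → ℤ) × Fin 4) × Fin 3 → ((Fin 4 → ℤ) × Fin 4) × Fin 3 → ℂ}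
variable {AdM : (n : ℕ) → (Site (F.P (recordK₀ F Mc k + n)) 0 → (MatA 2)ˣ) →
  Matrix (FluctIdx F k (recordK₀ F Mc k + n)) (FluctIdx F k (recordK₀ F Mc k + n)) ℂ}
variable {AdZ : ((Fin 4 → ℤ) → (MatA 2)ˣ) → (Fin 4 → ℤ) × Fin 4 → Matrix (Fin 3) (Fin 3) ℂ}

/-- Indices whose cube lies in a cube set `S`: at most `|S| · 3d(L·Mc)^d`. [cite: Balaban1987RG1, p.257 (bookkeeping)] -/
theorem card_filter_cube_mem_le {Mc k K : ℕ} (hMc : McGuard F Mc) (hK : recordK₀ F Mc k ≤ K) (S : Finset (TPt (F.P K).d (Sect2.domCount (F.P K) Mc (k + 1)))) :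
    (univ.filter fun s : NonB0Idx F k K => cubeOfSite F Mc k K (blockOf s.1.1.src) ∈ S).card ≤ S.card * (3 * (F.P K).d * (F.L * Mc) ^ (F.P K).d) := by
  have e : (univ.filter fun s : NonB0Idx F k K => cubeOfSite F Mc k K (blockOf s.1.1.src) ∈ S) =
      S.biUnion (fun c => univ.filter fun s : NonB0Idx F k K => cubeOfSite F Mc k K (blockOf s.1.1.src) = c) := by
    ext s
    simp only [Finset.mem_filter, Finset.mem_univ, true_and, Finset.mem_biUnion]
    constructor
    · intro h; exact ⟨_, h, rfl⟩
    · rintro ⟨c, hc, h⟩; rw [h]; exact hc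
  rw [e]
  refine (Finset.card_biUnion_le).trans ?_
  rw [mul_comm]
  refine (Finset.sum_le_sum fun c _ => card_filter_cube_le hMc hK c).trans ?_
  rw [Finset.sum_const, smul_eq_mul, mul_comm]

/-- Indices in the block domain `□̃(q)`: at most `3^d · 3^d · 3d(L·Mc)^d` (cube form via ✓`cubeOfSite_blockOf_mem_of_embIter_mem_domSites`). [cite: Balaban1987RG1, p.257 (bookkeeping)] -/
theorem card_filter_inDom_blk_le {Mc k K : ℕ} (hMc : McGuard F Mc) (hK : recordK₀ F Mc k ≤ K) (q : TPt (F.P K).d (Sect2.domCount (F.P K) Mc (k + 1))) :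
    (univ.filter fun s : NonB0Idx F k K => g3cInDom F Mc k K (g3cBlk F Mc k K q) s).card ≤
      3 ^ (F.P K).d * 3 ^ (F.P K).d * (3 * (F.P K).d * (F.L * Mc) ^ (F.P K).d) := by
  refine (Finset.card_le_card (s := univ.filter fun s : NonB0Idx F k K => g3cInDom F Mc k K (g3cBlk F Mc k K q) s)
    (t := univ.filter fun s : NonB0Idx F k K => cubeOfSite F Mc k K (blockOf s.1.1.src) ∈ (g3cBlk F Mc k K q).1) ?_).trans ?_
  · intro s hs
    rw [Finset.mem_filter] at hs ⊢
    exact ⟨hs.1, cubeOfSite_blockOf_mem_of_embIter_mem_domSites hMc hK _ _ hs.2⟩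
  · refine (card_filter_cube_mem_le hMc hK _).trans ?_
    have hc : (g3cBlk F Mc k K q).1.card ≤ 3 ^ (F.P K).d * 3 ^ (F.P K).d := by
      show (tcollar (tblock q)).card ≤ _
      exact (card_tcollar_le _).trans (Nat.mul_le_mul_left _ (card_tblock_le q))
    exact Nat.mul_le_mul_right _ hc

/-- **Column support of `T_Y` in cube form**: `T_Y · D_Y = T_Y` for the projection `D_Y` onto indices whose cube lies in `Y`. [cite: Balaban1987RG1, (1.7) p.261] -/
theorem nonB0Block_mul_cubeProj (hP : P0CarrierClauses F a₀ δ₀ c₀ γ₀ γ₁ Mc α₀ α₁ ε₂₉ k TC TY TZY AdM AdZ) (hMc : McGuard F Mc) (n : ℕ)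
    (Y : (recordDomSys F Mc k (recordK₀ F Mc k + n)).Dom) (φ : Sect2.CPair (F.P (recordK₀ F Mc k + n)) (MatA 2)) :
    nonB0Block F k (recordK₀ F Mc k + n) (TY n Y φ) *
        Matrix.diagonal (fun s : NonB0Idx F k (recordK₀ F Mc k + n) =>
          if cubeOfSite F Mc k (recordK₀ F Mc k + n) (blockOf s.1.1.src) ∈ (Y.1 : Finset _) then (1 : ℂ) else 0) =
      nonB0Block F k (recordK₀ F Mc k + n) (TY n Y φ) := by
  obtain ⟨-, -, -, -, -, -, -, -, hSupp, -⟩ := hP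
  have hK : recordK₀ F Mc k ≤ recordK₀ F Mc k + n := Nat.le_add_right _ _
  ext i j
  rw [Matrix.mul_diagonal]
  by_cases hj : cubeOfSite F Mc k (recordK₀ F Mc k + n) (blockOf j.1.1.src) ∈ (Y.1 : Finset _)
  · rw [if_pos hj, mul_one]
  · rw [if_neg hj, mul_zero, nonB0Block, Matrix.of_apply, fluct_supp_of_cube hMc hK (hSupp n) Y φ i j (Or.inr hj)]

/-- Entries of `W := D_Y·P_□̃·G_□·𝟙_□` in closed form. [folklore] -/
theorem W_apply (Mc k K : ℕ) (TYK : (recordDomSys F Mc k K).Dom → Sect2.CPair (F.P K) (MatA 2) → FluctIdx F k K → FluctIdx F k K → ℂ)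
    (q : TPt (F.P K).d (Sect2.domCount (F.P K) Mc (k + 1))) (Y : (recordDomSys F Mc k K).Dom) (x : ℝ) (φ : Sect2.CPair (F.P K) (MatA 2)) (l m : NonB0Idx F k K) :
    (Matrix.diagonal (fun s : NonB0Idx F k K => if cubeOfSite F Mc k K (blockOf s.1.1.src) ∈ (Y.1 : Finset _) then (1 : ℂ) else 0) *
        g3cProj F Mc k K (g3cBlk F Mc k K q) * g3cLocInv F Mc k K TYK (g3cBlk F Mc k K q) x φ * g3cInd F Mc k K q) l m =
      ((if cubeOfSite F Mc k K (blockOf l.1.1.src) ∈ (Y.1 : Finset _) then (1 : ℂ) else 0) * (if g3cInDom F Mc k K (g3cBlk F Mc k K q) l then (1 : ℂ) else 0)) *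
        g3cLocInv F Mc k K TYK (g3cBlk F Mc k K q) x φ l m *
        (((if cubeOfSite F Mc k K (blockOf m.1.1.src) = q then (1 : ℝ) else 0 : ℝ) : ℂ)) := by
  rw [g3cProj, Matrix.diagonal_mul_diagonal, g3cInd, Matrix.mul_diagonal, Matrix.diagonal_mul]

/-- **Entries of `W`** for `Y` avoiding `tblock □`: `‖W l m‖ ≤ e^{−κ·L·Mc}/(γ₀/2)`; they vanish unless `cube(l) ∈ Y`, `l ∈ □̃` and `cube(m) = □`, and then `tdist(l, m) ≥ L·Mc`
(✓`mul_le_tdist_of_cube_not_mem_tblock`) feeds the lattice Combes–Thomas decay (✓`norm_g3cLocInv_apply_le_exp`). [cite: Balaban1985BackgroundPropagators, (3.94) p.410, (3.42) p.399] -/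
theorem norm_W_apply_le (hP : P0CarrierClauses F a₀ δ₀ c₀ γ₀ γ₁ Mc α₀ α₁ ε₂₉ k TC TY TZY AdM AdZ)
    (hL : P0CarrierLatticeDecay F δ₀ c₀ δ₁ Mc α₀ α₁ k TY) (hMc : McGuard F Mc) (hc₀ : 0 ≤ c₀) (hγ₀ : 0 < γ₀) (hδ₁ : 0 < δ₁)
    (hδ₀ : kappa₀ (4 * 2 ^ 4) (2 * 4) ≤ δ₀) {κ : ℝ} (hκ : 0 ≤ κ) (hκδ : 2 * κ ≤ δ₁) (hκc : 4 * κ * (c₀ * K₀ (4 * 2 ^ 4) (2 * 4)) ≤ γ₀ * δ₁) (n : ℕ)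
    (q : TPt (F.P (recordK₀ F Mc k + n)).d (Sect2.domCount (F.P (recordK₀ F Mc k + n)) Mc (k + 1))) (Y : (recordDomSys F Mc k (recordK₀ F Mc k + n)).Dom)
    (hY : ∀ c ∈ (Y.1 : Finset _), c ∉ tblock q) {φ : Sect2.CPair (F.P (recordK₀ F Mc k + n)) (MatA 2)}
    (hφq : encodeCfg F (recordK₀ F Mc k + n) φ ∈ recordUc F Mc k α₀ α₁ (recordK₀ F Mc k + n) (g3cBlk F Mc k (recordK₀ F Mc k + n) q)) {x : ℝ} (hx : 0 ≤ x)
    (l m : NonB0Idx F k (recordK₀ F Mc k + n)) :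
    ‖(Matrix.diagonal (fun s : NonB0Idx F k (recordK₀ F Mc k + n) =>
          if cubeOfSite F Mc k (recordK₀ F Mc k + n) (blockOf s.1.1.src) ∈ (Y.1 : Finset _) then (1 : ℂ) else 0) *
        g3cProj F Mc k (recordK₀ F Mc k + n) (g3cBlk F Mc k (recordK₀ F Mc k + n) q) *
        g3cLocInv F Mc k (recordK₀ F Mc k + n) (TY n) (g3cBlk F Mc k (recordK₀ F Mc k + n) q) x φ * g3cInd F Mc k (recordK₀ F Mc k + n) q) l m‖ ≤ Real.exp (-(κ * ((F.L * Mc : ℕ) : ℝ))) / (γ₀ / 2) := by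
  have hK : recordK₀ F Mc k ≤ recordK₀ F Mc k + n := Nat.le_add_right _ _
  have hB0 : 0 ≤ Real.exp (-(κ * ((F.L * Mc : ℕ) : ℝ))) / (γ₀ / 2) := by positivity
  rw [W_apply]
  by_cases hl : cubeOfSite F Mc k (recordK₀ F Mc k + n) (blockOf l.1.1.src) ∈ (Y.1 : Finset _)
  · by_cases hm : cubeOfSite F Mc k (recordK₀ F Mc k + n) (blockOf m.1.1.src) = q
    · have hG := norm_g3cLocInv_apply_le_exp hP hL hMc hc₀ hγ₀ hδ₁ hδ₀ hκ hκδ hκc n (g3cBlk F Mc k (recordK₀ F Mc k + n) q) hφq hx l m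
      have htd : F.L * Mc ≤ Site.tdist l.1.1.src m.1.1.src :=
        G3CGeom.mul_le_tdist_of_cube_not_mem_tblock hMc hK _ _ (by rw [hm]; exact hY _ hl)
      have hmono : Real.exp (-(κ * (Site.tdist l.1.1.src m.1.1.src : ℝ))) ≤ Real.exp (-(κ * ((F.L * Mc : ℕ) : ℝ))) := by
        apply Real.exp_le_exp.2
        have : ((F.L * Mc : ℕ) : ℝ) ≤ (Site.tdist l.1.1.src m.1.1.src : ℝ) := by exact_mod_cast htd
        nlinarith
      have hfac1 : ‖(if cubeOfSite F Mc k (recordK₀ F Mc k + n) (blockOf l.1.1.src) ∈ (Y.1 : Finset _) then (1 : ℂ) else 0) *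
          (if g3cInDom F Mc k (recordK₀ F Mc k + n) (g3cBlk F Mc k (recordK₀ F Mc k + n) q) l then (1 : ℂ) else 0)‖ ≤ 1 := by
        rw [norm_mul]
        have a1 : ‖(if cubeOfSite F Mc k (recordK₀ F Mc k + n) (blockOf l.1.1.src) ∈ (Y.1 : Finset _) then (1 : ℂ) else 0)‖ ≤ 1 := by rw [if_pos hl]; simp
        have a2 : ‖(if g3cInDom F Mc k (recordK₀ F Mc k + n) (g3cBlk F Mc k (recordK₀ F Mc k + n) q) l then (1 : ℂ) else 0)‖ ≤ 1 := by split_ifs <;> simp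
        exact mul_le_one₀ a1 (norm_nonneg _) a2
      have hfac3 : ‖(((if cubeOfSite F Mc k (recordK₀ F Mc k + n) (blockOf m.1.1.src) = q then (1 : ℝ) else 0 : ℝ)) : ℂ)‖ ≤ 1 := by
        rw [Complex.norm_real, if_pos hm]; simp
      calc ‖(if cubeOfSite F Mc k (recordK₀ F Mc k + n) (blockOf l.1.1.src) ∈ (Y.1 : Finset _) then (1 : ℂ) else 0) *
              (if g3cInDom F Mc k (recordK₀ F Mc k + n) (g3cBlk F Mc k (recordK₀ F Mc k + n) q) l then (1 : ℂ) else 0) *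
              g3cLocInv F Mc k (recordK₀ F Mc k + n) (TY n) (g3cBlk F Mc k (recordK₀ F Mc k + n) q) x φ l m *
              (((if cubeOfSite F Mc k (recordK₀ F Mc k + n) (blockOf m.1.1.src) = q then (1 : ℝ) else 0 : ℝ)) : ℂ)‖
          ≤ 1 * ‖g3cLocInv F Mc k (recordK₀ F Mc k + n) (TY n) (g3cBlk F Mc k (recordK₀ F Mc k + n) q) x φ l m‖ * 1 := by
            rw [norm_mul, norm_mul]
            exact mul_le_mul (mul_le_mul_of_nonneg_right hfac1 (norm_nonneg _)) hfac3 (norm_nonneg _) (by positivity)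
        _ ≤ Real.exp (-(κ * ((F.L * Mc : ℕ) : ℝ))) / (γ₀ / 2) := by
            rw [one_mul, mul_one]; exact hG.trans (div_le_div_of_nonneg_right hmono (by positivity))
    · rw [if_neg hm]; simpa using hB0
  · rw [if_neg hl]; simpa using hB0

/-- `W l m = 0` unless `cube(m) = □`. [folklore] -/
theorem W_apply_eq_zero_of_cube_ne (Mc k K : ℕ) (TYK : (recordDomSys F Mc k K).Dom → Sect2.CPair (F.P K) (MatA 2) → FluctIdx F k K → FluctIdx F k K → ℂ)
    (q : TPt (F.P K).d (Sect2.domCount (F.P K) Mc (k + 1))) (Y : (recordDomSys F Mc k K).Dom) (x : ℝ) (φ : Sect2.CPair (F.P K) (MatA 2)) {l m : NonB0Idx F k K}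
    (hm : cubeOfSite F Mc k K (blockOf m.1.1.src) ≠ q) :
    (Matrix.diagonal (fun s : NonB0Idx F k K => if cubeOfSite F Mc k K (blockOf s.1.1.src) ∈ (Y.1 : Finset _) then (1 : ℂ) else 0) *
        g3cProj F Mc k K (g3cBlk F Mc k K q) * g3cLocInv F Mc k K TYK (g3cBlk F Mc k K q) x φ * g3cInd F Mc k K q) l m = 0 := by
  rw [W_apply, if_neg hm]; simp

/-- `W l m = 0` unless `l ∈ □̃`. [folklore] -/
theorem W_apply_eq_zero_of_not_inDom (Mc k K : ℕ) (TYK : (recordDomSys F Mc k K).Dom → Sect2.CPair (F.P K) (MatA 2) → FluctIdx F k K → FluctIdx F k K → ℂ)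
    (q : TPt (F.P K).d (Sect2.domCount (F.P K) Mc (k + 1))) (Y : (recordDomSys F Mc k K).Dom) (x : ℝ) (φ : Sect2.CPair (F.P K) (MatA 2)) {l m : NonB0Idx F k K}
    (hl : ¬ g3cInDom F Mc k K (g3cBlk F Mc k K q) l) :
    (Matrix.diagonal (fun s : NonB0Idx F k K => if cubeOfSite F Mc k K (blockOf s.1.1.src) ∈ (Y.1 : Finset _) then (1 : ℂ) else 0) *
        g3cProj F Mc k K (g3cBlk F Mc k K q) * g3cLocInv F Mc k K TYK (g3cBlk F Mc k K q) x φ * g3cInd F Mc k K q) l m = 0 := by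
  rw [W_apply, if_neg hl]; simp

/-- ★ **`‖W‖ ≤ 3^8·(12(L·Mc)^4) · e^{−κ·L·Mc}/(γ₀/2)`** for `Y` avoiding `tblock □` (Schur test: rows run over the cube `□`, columns over `□̃`). [cite: Balaban1985BackgroundPropagators, (3.94) p.410] -/
theorem l2_opNorm_W_le (hP : P0CarrierClauses F a₀ δ₀ c₀ γ₀ γ₁ Mc α₀ α₁ ε₂₉ k TC TY TZY AdM AdZ)
    (hL : P0CarrierLatticeDecay F δ₀ c₀ δ₁ Mc α₀ α₁ k TY) (hMc : McGuard F Mc) (hc₀ : 0 ≤ c₀) (hγ₀ : 0 < γ₀) (hδ₁ : 0 < δ₁)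
    (hδ₀ : kappa₀ (4 * 2 ^ 4) (2 * 4) ≤ δ₀) {κ : ℝ} (hκ : 0 ≤ κ) (hκδ : 2 * κ ≤ δ₁) (hκc : 4 * κ * (c₀ * K₀ (4 * 2 ^ 4) (2 * 4)) ≤ γ₀ * δ₁) (n : ℕ)
    (q : TPt (F.P (recordK₀ F Mc k + n)).d (Sect2.domCount (F.P (recordK₀ F Mc k + n)) Mc (k + 1))) (Y : (recordDomSys F Mc k (recordK₀ F Mc k + n)).Dom)
    (hY : ∀ c ∈ (Y.1 : Finset _), c ∉ tblock q) {φ : Sect2.CPair (F.P (recordK₀ F Mc k + n)) (MatA 2)}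
    (hφq : encodeCfg F (recordK₀ F Mc k + n) φ ∈ recordUc F Mc k α₀ α₁ (recordK₀ F Mc k + n) (g3cBlk F Mc k (recordK₀ F Mc k + n) q)) {x : ℝ} (hx : 0 ≤ x) :
    ‖(Matrix.diagonal (fun s : NonB0Idx F k (recordK₀ F Mc k + n) =>
          if cubeOfSite F Mc k (recordK₀ F Mc k + n) (blockOf s.1.1.src) ∈ (Y.1 : Finset _) then (1 : ℂ) else 0) *
        g3cProj F Mc k (recordK₀ F Mc k + n) (g3cBlk F Mc k (recordK₀ F Mc k + n) q) *
        g3cLocInv F Mc k (recordK₀ F Mc k + n) (TY n) (g3cBlk F Mc k (recordK₀ F Mc k + n) q) x φ * g3cInd F Mc k (recordK₀ F Mc k + n) q)‖ ≤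
      (3 ^ 4 * 3 ^ 4 * (3 * 4 * (F.L * Mc) ^ 4) : ℕ) * (Real.exp (-(κ * ((F.L * Mc : ℕ) : ℝ))) / (γ₀ / 2)) := by
  have hK : recordK₀ F Mc k ≤ recordK₀ F Mc k + n := Nat.le_add_right _ _
  set B : ℝ := Real.exp (-(κ * ((F.L * Mc : ℕ) : ℝ))) / (γ₀ / 2) with hB
  have hB0 : 0 ≤ B := by positivity
  set Nq : ℕ := 3 ^ 4 * 3 ^ 4 * (3 * 4 * (F.L * Mc) ^ 4) with hNq
  have hW := norm_W_apply_le hP hL hMc hc₀ hγ₀ hδ₁ hδ₀ hκ hκδ hκc n q Y hY hφq hx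
  have hrowcnt : ((univ.filter fun s : NonB0Idx F k (recordK₀ F Mc k + n) =>
      cubeOfSite F Mc k (recordK₀ F Mc k + n) (blockOf s.1.1.src) = q).card : ℝ) ≤ Nq := by
    have h : (univ.filter fun s : NonB0Idx F k (recordK₀ F Mc k + n) => cubeOfSite F Mc k (recordK₀ F Mc k + n) (blockOf s.1.1.src) = q).card ≤
        3 * 4 * (F.L * Mc) ^ 4 := card_filter_cube_le hMc hK q
    have h' : 3 * 4 * (F.L * Mc) ^ 4 ≤ Nq := by rw [hNq]; exact Nat.le_mul_of_pos_left _ (by positivity)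
    exact_mod_cast h.trans h'
  have hcolcnt : ((univ.filter fun s : NonB0Idx F k (recordK₀ F Mc k + n) =>
      g3cInDom F Mc k (recordK₀ F Mc k + n) (g3cBlk F Mc k (recordK₀ F Mc k + n) q) s).card : ℝ) ≤ Nq := by
    have h : (univ.filter fun s : NonB0Idx F k (recordK₀ F Mc k + n) => g3cInDom F Mc k (recordK₀ F Mc k + n) (g3cBlk F Mc k (recordK₀ F Mc k + n) q) s).card ≤
        3 ^ 4 * 3 ^ 4 * (3 * 4 * (F.L * Mc) ^ 4) := card_filter_inDom_blk_le hMc hK q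
    exact_mod_cast h
  refine l2_opNorm_le_of_row_col_sum _ (by positivity) (fun l => ?_) (fun m => ?_)
  · -- row l: only the columns of cube q contribute
    calc ∑ m, ‖(_ : Matrix _ _ ℂ) l m‖
        = ∑ m : NonB0Idx F k (recordK₀ F Mc k + n), (if cubeOfSite F Mc k (recordK₀ F Mc k + n) (blockOf m.1.1.src) = q then
            ‖(Matrix.diagonal (fun s : NonB0Idx F k (recordK₀ F Mc k + n) =>
          if cubeOfSite F Mc k (recordK₀ F Mc k + n) (blockOf s.1.1.src) ∈ (Y.1 : Finset _) then (1 : ℂ) else 0) *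
        g3cProj F Mc k (recordK₀ F Mc k + n) (g3cBlk F Mc k (recordK₀ F Mc k + n) q) *
        g3cLocInv F Mc k (recordK₀ F Mc k + n) (TY n) (g3cBlk F Mc k (recordK₀ F Mc k + n) q) x φ * g3cInd F Mc k (recordK₀ F Mc k + n) q) l m‖ else 0) := by
          refine Finset.sum_congr rfl fun m _ => ?_
          split_ifs with hm
          · rfl
          · rw [W_apply_eq_zero_of_cube_ne Mc k _ (TY n) q Y x φ hm, norm_zero]
      _ ≤ ∑ m : NonB0Idx F k (recordK₀ F Mc k + n), (if cubeOfSite F Mc k (recordK₀ F Mc k + n) (blockOf m.1.1.src) = q then B else 0) := by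
          refine Finset.sum_le_sum fun m _ => ?_
          split_ifs
          · exact hW l m
          · exact le_rfl
      _ = ((univ.filter fun s : NonB0Idx F k (recordK₀ F Mc k + n) => cubeOfSite F Mc k (recordK₀ F Mc k + n) (blockOf s.1.1.src) = q).card : ℝ) * B := by
          rw [← Finset.sum_filter, Finset.sum_const, nsmul_eq_mul]
      _ ≤ Nq * B := mul_le_mul_of_nonneg_right hrowcnt hB0
  · -- column m: only the rows in □̃ contribute
    calc ∑ l, ‖(_ : Matrix _ _ ℂ) l m‖
        = ∑ l : NonB0Idx F k (recordK₀ F Mc k + n), (if g3cInDom F Mc k (recordK₀ F Mc k + n) (g3cBlk F Mc k (recordK₀ F Mc k + n) q) l then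
            ‖(Matrix.diagonal (fun s : NonB0Idx F k (recordK₀ F Mc k + n) =>
          if cubeOfSite F Mc k (recordK₀ F Mc k + n) (blockOf s.1.1.src) ∈ (Y.1 : Finset _) then (1 : ℂ) else 0) *
        g3cProj F Mc k (recordK₀ F Mc k + n) (g3cBlk F Mc k (recordK₀ F Mc k + n) q) *
        g3cLocInv F Mc k (recordK₀ F Mc k + n) (TY n) (g3cBlk F Mc k (recordK₀ F Mc k + n) q) x φ * g3cInd F Mc k (recordK₀ F Mc k + n) q) l m‖ else 0) := by
          refine Finset.sum_congr rfl fun l _ => ?_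
          split_ifs with hl
          · rfl
          · rw [W_apply_eq_zero_of_not_inDom Mc k _ (TY n) q Y x φ hl, norm_zero]
      _ ≤ ∑ l : NonB0Idx F k (recordK₀ F Mc k + n), (if g3cInDom F Mc k (recordK₀ F Mc k + n) (g3cBlk F Mc k (recordK₀ F Mc k + n) q) l then B else 0) := by
          refine Finset.sum_le_sum fun l _ => ?_
          split_ifs
          · exact hW l m
          · exact le_rfl
      _ = ((univ.filter fun s : NonB0Idx F k (recordK₀ F Mc k + n) => g3cInDom F Mc k (recordK₀ F Mc k + n) (g3cBlk F Mc k (recordK₀ F Mc k + n) q) s).card : ℝ) * B := by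
          rw [← Finset.sum_filter, Finset.sum_const, nsmul_eq_mul]
      _ ≤ Nq * B := mul_le_mul_of_nonneg_right hcolcnt hB0

/-- ★★ **THE NEAR-STEP BOUND**: for `Y` avoiding `tblock □`, `x ≥ 0`, `φ` in the record spaces of `Y` and `□̃`:
`‖S_{□,Y}(x, φ)‖ ≤ c₀e^{−δ₀d_j(Y)} · 3^8·(12(L·Mc)^4) · e^{−κ·L·Mc}/(γ₀/2)`. [cite: Balaban1985BackgroundPropagators, (3.94) p.410; Balaban1985UV3, (23) p.262] -/
theorem l2_opNorm_g3cStep_le_near (hP : P0CarrierClauses F a₀ δ₀ c₀ γ₀ γ₁ Mc α₀ α₁ ε₂₉ k TC TY TZY AdM AdZ)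
    (hL : P0CarrierLatticeDecay F δ₀ c₀ δ₁ Mc α₀ α₁ k TY) (hMc : McGuard F Mc) (hc₀ : 0 ≤ c₀) (hγ₀ : 0 < γ₀) (hδ₁ : 0 < δ₁)
    (hδ₀ : kappa₀ (4 * 2 ^ 4) (2 * 4) ≤ δ₀) {κ : ℝ} (hκ : 0 ≤ κ) (hκδ : 2 * κ ≤ δ₁) (hκc : 4 * κ * (c₀ * K₀ (4 * 2 ^ 4) (2 * 4)) ≤ γ₀ * δ₁) (n : ℕ)
    (q : TPt (F.P (recordK₀ F Mc k + n)).d (Sect2.domCount (F.P (recordK₀ F Mc k + n)) Mc (k + 1))) (Y : (recordDomSys F Mc k (recordK₀ F Mc k + n)).Dom)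
    (hY : ∀ c ∈ (Y.1 : Finset _), c ∉ tblock q) {φ : Sect2.CPair (F.P (recordK₀ F Mc k + n)) (MatA 2)}
    (hφY : encodeCfg F (recordK₀ F Mc k + n) φ ∈ recordUc F Mc k α₀ α₁ (recordK₀ F Mc k + n) Y)
    (hφq : encodeCfg F (recordK₀ F Mc k + n) φ ∈ recordUc F Mc k α₀ α₁ (recordK₀ F Mc k + n) (g3cBlk F Mc k (recordK₀ F Mc k + n) q)) {x : ℝ} (hx : 0 ≤ x) :
    ‖g3cStep F Mc k (recordK₀ F Mc k + n) (TY n) q Y x φ‖ ≤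
      c₀ * Real.exp (-(δ₀ * (recordDomSys F Mc k (recordK₀ F Mc k + n)).dj Y)) *
        ((3 ^ 4 * 3 ^ 4 * (3 * 4 * (F.L * Mc) ^ 4) : ℕ) * (Real.exp (-(κ * ((F.L * Mc : ℕ) : ℝ))) / (γ₀ / 2))) := by
  have hT := l2_opNorm_nonB0Block_TY_le hP hc₀ n Y hφY
  have hW := l2_opNorm_W_le hP hL hMc hc₀ hγ₀ hδ₁ hδ₀ hκ hκδ hκc n q Y hY hφq hx
  have hsupp := nonB0Block_mul_cubeProj hP hMc n Y φ
  rw [g3cStep, ← hsupp]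
  simp only [Matrix.mul_assoc] at hW ⊢
  exact (norm_mul_le _ _).trans (mul_le_mul hT hW (norm_nonneg _) (by positivity))

end Near

end Summit.QuantumFields.YangMills.Theorems.BalabanUVNodesPortS1

end
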